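import Mathlib
import Summits.NavierStokesRegularity.NavierStokesRegularity.Theorems.TaoLadderRungTwoBreakBlowupRigidityOneVoidTables
import Summits.NavierStokesRegularity.NavierStokesRegularity.Theorems.TaoLadderRungTwoBreakBlowupRigidityOneSquareFreeOneMode
import Summits.NavierStokesRegularity.NavierStokesRegularity.Theses.TaoLadderRungTwoBreak
import HarnessLib

/-!
# The ETERNAL side of the void corner of K2(1): on an outflow-free cancelling table every admissible eternal
  solution of the renormalised lattice is trivial, so the hypothesis class of the registered classification stub
  `stub_eternalIsDSS` of `TaoLadderRungTwoBreak.BlowupRigidityOne` (stmt-NavierStokesRegularity-20206) is void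
  there; below the dyadic spread both stubs and the crux live on tables with a live CROSS outflow and on data
  charging two modes (by-name normal forms)

MODEL lattice ODEs only (Tao 2016 §4 (4.1)–(4.3), Lemma 4.1 (4.8) in the self-similar variables of §6.4); nothing
here is a statement about the Navier–Stokes equations; NO item is closed (`--supports stmt-NavierStokesRegularity-20206`).
DEF-FREE (outflow-free = the hypothesis `∀ i₁ i₂ i, α i₁ i₂ i (0,0,1) = 0`).

The registered skeleton of K2(1) (sha16 9d85f4d387c689cd) composes `stub_eternalFromBlowup` (robust blow-up ⇒ an
admissible eternal solution `W` of the renormalised lattice, `IsEternal ε₀ α W`, that is (S₁)-surviving forward,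
`EternalSurvivingFwd 1 ε₀ W`) with `stub_eternalIsDSS` (such a `W` ⇒ a non-trivial (S₁)-surviving admissible DSS
wave).  `…VoidTables` settled the WAVE side and the BLOW-UP side on outflow-free tables; this file adds the
ETERNAL side and the sub-dyadic bookkeeping:

* `norm_sq_eternal_of_outflow_zero` — on a cancelling table with `tableA α = 0` every shell of an admissible
  eternal solution has `‖W_n(σ)‖² = ‖W_n(0)‖² e^{−2σ}` (intra-shell neutrality `⟪x,Qx⟫ = 0` and the type-split
  cancellation `⟪x,B(y,x)⟫ = −⟪y,Ax⟫ = 0`: feed and back-reaction do no work; `table_sTable`);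
* `eternal_trivial_of_outflow_zero` — hence the ACTION clause of `IsEternal` (`σ ↦ ‖W_n(σ)‖` integrable on `ℝ`)
  forces `W ≡ 0` (`‖W_n(0)‖e^{−σ}` is not integrable unless `W_n(0) = 0`; `not_integrable_exp_neg`);
* `not_eternalSurvivingFwd_of_outflow_zero`, `stubEternalIsDSS_on_outflow_zero` — so NO admissible eternal solution
  of an outflow-free cancelling table is (S_a)-surviving forward (any `a`, any `ε₀`), and the classification stub
  holds there vacuously: like the crux, `stub_eternalIsDSS` has content only on tables with a live outflow;
* `abs_outflow_le_fluxConst`, `exists_outflow_ge_of_eternalSurviving`, `fluxConst_ge_of_eternalSurviving` —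
  NUMBERS: on `E₂(R)` a forward-surviving admissible eternal solution forces some `|α_{i₁i₂i,(0,0,1)}| ≥ R⁻¹`, hence
  `fluxConst α ≥ R⁻¹` (the eternal analogue of `fluxConst_ge_of_noGlobalCascade` / `…_of_dssWave_nontrivial`);
* `exists_crossOutflow_ge_of_noGlobalCascade_of_lt_two`, `exists_crossOutflow_ge_of_dssWave_nontrivial_of_lt_two`,
  `exists_crossOutflow_ge_of_eternalSurviving_of_lt_two` — BELOW THE DYADIC SPREAD (`0 < R < 2`, where `E₂(R)` is
  square-free: `isSquareFreeCoeff_of_lt_two`) the live outflow constant forced by a robust blow-up, by a non-trivial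
  admissible DSS wave, or by a surviving admissible eternal solution is a CROSS coefficient `α_{jk i,(0,0,1)}`, `j ≠ k`,
  of modulus `≥ R⁻¹ > 1/2`;
* `blowupRigidityOne_iff_twoModes_below_two`, `target_iff_twoModes_below_two` — BY-NAME NORMAL FORMS: K2(1) and the
  rung leaf `Target` are equivalent to their restrictions to data charging TWO DISTINCT MODES whenever `R < 2`
  (`two_modes_of_noGlobalCascade_of_lt_two`); combined with `…LiveTables` (`fluxConst α ≥ R⁻¹`, `X₀ ≠ 0`) this is
  where any proof or refutation of K2(1) below the dyadic spread must work.

HONEST LABEL: calibration / bookkeeping for one aside leaf; no stub, crux, rung or summit is proved; rung 0.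
-/

noncomputable section

-- the summit and its single sub-problem share the name (CONVENTIONS §1)
set_option linter.dupNamespace false

open Set Filter Topology MeasureTheory
open scoped RealInnerProductSpace

namespace Summit.NavierStokesRegularity.NavierStokesRegularity.Theorems

namespace BlowupRigidityOne

open Literature.Analysis.FluidPDE Literature.Analysis.FluidPDE.TaoCascade
  Literature.Analysis.FluidPDE.Tao2016AveragedNS
open Summit.NavierStokesRegularity.NavierStokesRegularity.Theses.TaoLadderRungTwoBreak

variable {m : ℕ} {R ε₀ : ℝ} {α : Fin m → Fin m → Fin m → ℤ × ℤ × ℤ → ℝ}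

/-! ## Admissible eternal solutions of an outflow-free table are trivial -/

/-- **Feed and back-reaction do no work on an outflow-free cancelling table (eternal form).** If `α` is
cancelling with every structure constant at the outflow shift `(0,0,1)` equal to `0`, then every shell of an
admissible eternal solution of the renormalised lattice of `α` (`IsEternal ε₀ α W`, ANY `ε₀`) satisfies
`‖W_n(σ)‖² = ‖W_n(0)‖² e^{−2σ}`: the law reads `W_n' = −W_n + Q(W_n) + Λ⁻¹B(W_{n+1},W_n)` with `⟪x,Qx⟫ = 0` and
`⟪x,B(y,x)⟫ = −⟪y,Ax⟫ = 0` (`table_sTable`).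
[cite: Tao2016AveragedNS, §4 (4.3) and Lemma 4.1 (iii) (4.8) in self-similar variables (§6.4); cell vocabulary (`IsEternal`)] -/
theorem norm_sq_eternal_of_outflow_zero (hc : IsCancellingCoeff α)
    (hA : ∀ i₁ i₂ i, α i₁ i₂ i ((0 : ℤ), (0 : ℤ), (1 : ℤ)) = 0) {W : ℤ → ℝ → Em m}
    (hW : IsEternal ε₀ α W) (n : ℤ) (σ : ℝ) :
    ‖W n σ‖ ^ 2 = ‖W n 0‖ ^ 2 * Real.exp (-(2 * σ)) := by
  have hST := table_sTable α hc
  -- the shell energy solves `f' = -2 f`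
  have hder : ∀ z, HasDerivAt (fun z => ‖W n z‖ ^ 2) (-(2 * ‖W n z‖ ^ 2)) z := by
    intro z
    have h := (hW.law n z).norm_sq
    have hin : ⟪W n z, -((1 : ℝ) • W n z) + tableQ α (W n z)
        + bigLam ε₀ • tableA α (W (n - 1) z)
        + (bigLam ε₀)⁻¹ • tableB α (W (n + 1) z) (W n z)⟫ = -‖W n z‖ ^ 2 := by
      rw [inner_add_right, inner_add_right, inner_add_right, inner_neg_right, inner_smul_right,
        inner_smul_right, inner_smul_right, real_inner_self_eq_norm_sq, hST.intra,
        tableA_eq_zero_of_outflow_zero hA, inner_zero_right]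
      have hB : ⟪W n z, tableB α (W (n + 1) z) (W n z)⟫ = 0 := by
        have h2 := hST.cancel (W n z) (W (n + 1) z)
        rw [tableA_eq_zero_of_outflow_zero hA, inner_zero_right, zero_add] at h2
        exact h2
      rw [hB]
      ring
    rw [hin] at h
    convert h using 1
    ring
  -- hence `e^{2z} f(z)` is constant
  have hconst : ∀ z, Real.exp (2 * z) * ‖W n z‖ ^ 2 = ‖W n 0‖ ^ 2 := by
    intro z
    have hd : ∀ w, HasDerivAt (fun w => Real.exp (2 * w) * ‖W n w‖ ^ 2) 0 w := by
      intro w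
      have he : HasDerivAt (fun w => Real.exp (2 * w)) (Real.exp (2 * w) * 2) w := by
        have := (hasDerivAt_id w).const_mul (2 : ℝ)
        simp only [mul_one] at this
        exact (Real.hasDerivAt_exp (2 * w)).comp w this
      have h1 := he.mul (hder w)
      have e : Real.exp (2 * w) * 2 * ‖W n w‖ ^ 2 + Real.exp (2 * w) * (-(2 * ‖W n w‖ ^ 2)) = 0 := by
        ring
      rw [e] at h1
      exact h1
    have h := is_const_of_deriv_eq_zero (f := fun w => Real.exp (2 * w) * ‖W n w‖ ^ 2)
      (fun w => (hd w).differentiableAt) (fun w => (hd w).deriv) z 0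
    simpa using h
  have h := hconst σ
  have hexp : Real.exp (2 * σ) * Real.exp (-(2 * σ)) = 1 := by
    rw [← Real.exp_add, add_neg_cancel, Real.exp_zero]
  calc ‖W n σ‖ ^ 2 = Real.exp (2 * σ) * ‖W n σ‖ ^ 2 * Real.exp (-(2 * σ)) := by
        rw [mul_comm (Real.exp (2 * σ)), mul_assoc, hexp, mul_one]
    _ = ‖W n 0‖ ^ 2 * Real.exp (-(2 * σ)) := by rw [h]

/-- **NO NON-TRIVIAL ADMISSIBLE ETERNAL SOLUTION ON AN OUTFLOW-FREE TABLE.** If `α` is cancelling with every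
structure constant at `(0,0,1)` equal to `0`, then every admissible eternal solution of the renormalised lattice of
`α` (`IsEternal ε₀ α W`, ANY `ε₀`) vanishes identically: by `norm_sq_eternal_of_outflow_zero` each shell has mass
`‖W_n(σ)‖ = ‖W_n(0)‖e^{−σ}`, which the uniform ACTION clause (`σ ↦ ‖W_n(σ)‖` integrable on `ℝ`) excludes unless
`W_n(0) = 0` (`not_integrable_exp_neg`).  (Placement: the `σ`-constant separable blow-up of an outflow-LIVE chain is
excluded by the same clause — docstring of `IsEternal`.)
[cite: Tao2016AveragedNS, §4 (4.3), Lemma 4.1 (iii) (4.8) in self-similar variables (§6.4); cell vocabulary (`IsEternal`, clause `action`)] -/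
theorem eternal_trivial_of_outflow_zero (hc : IsCancellingCoeff α)
    (hA : ∀ i₁ i₂ i, α i₁ i₂ i ((0 : ℤ), (0 : ℤ), (1 : ℤ)) = 0) {W : ℤ → ℝ → Em m}
    (hW : IsEternal ε₀ α W) : ∀ n σ, W n σ = 0 := by
  intro n
  -- Step 1: `‖W_n(0)‖ = 0`, else `e^{-σ}` would be integrable
  have h0 : ‖W n 0‖ = 0 := by
    by_contra hne
    obtain ⟨M, hM⟩ := hW.action
    have hint : Integrable (fun σ => ‖W n σ‖) := (hM n).1
    have heq : (fun σ => ‖W n σ‖) = fun σ => ‖W n 0‖ * Real.exp (-σ) := by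
      funext σ
      have hsq := norm_sq_eternal_of_outflow_zero hc hA hW n σ
      have hrhs : ‖W n 0‖ ^ 2 * Real.exp (-(2 * σ)) = (‖W n 0‖ * Real.exp (-σ)) ^ 2 := by
        have h2 : Real.exp (-(2 * σ)) = Real.exp (-σ) ^ 2 := by
          rw [sq, ← Real.exp_add]
          exact congrArg Real.exp (by ring)
        rw [h2, mul_pow]
      rw [hrhs] at hsq
      exact (pow_left_inj₀ (norm_nonneg _) (by positivity) two_ne_zero).1 hsq
    rw [heq] at hint
    have hexp : Integrable (fun σ : ℝ => Real.exp (-σ)) := by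
      have := hint.const_mul (‖W n 0‖⁻¹)
      refine this.congr (Eventually.of_forall fun σ => ?_)
      simp only
      rw [← mul_assoc, inv_mul_cancel₀ hne, one_mul]
    exact not_integrable_exp_neg hexp
  -- Step 2: the energy identity propagates `W_n(0) = 0` to every `σ`
  intro σ
  have hsq := norm_sq_eternal_of_outflow_zero hc hA hW n σ
  rw [h0] at hsq
  simp only [ne_eq, OfNat.ofNat_ne_zero, not_false_eq_true, zero_pow, zero_mul] at hsq
  exact norm_eq_zero.1 (pow_eq_zero_iff two_ne_zero |>.1 hsq)

/-- **No admissible eternal solution of an outflow-free cancelling table is (S_a)-surviving forward** — any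
exponent `a`, ANY `ε₀`: the solution is `0` (`eternal_trivial_of_outflow_zero`), so no positive level of the
weighted shell energy is ever reached.
[cite: Tao2016AveragedNS, §4 (4.3), (4.8), the viscous remark before Thm. 4.2; cell vocabulary (`IsEternal`, `EternalSurvivingFwd`)] -/
theorem not_eternalSurvivingFwd_of_outflow_zero (hc : IsCancellingCoeff α)
    (hA : ∀ i₁ i₂ i, α i₁ i₂ i ((0 : ℤ), (0 : ℤ), (1 : ℤ)) = 0) {W : ℤ → ℝ → Em m}
    (hW : IsEternal ε₀ α W) (a : ℝ) : ¬ EternalSurvivingFwd a ε₀ W := by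
  rintro ⟨c, hc0, H⟩
  obtain ⟨n, -, σ, -, hle⟩ := H 0
  rw [eternal_trivial_of_outflow_zero hc hA hW n σ, norm_zero] at hle
  simp only [ne_eq, OfNat.ofNat_ne_zero, not_false_eq_true, zero_pow, mul_zero] at hle
  exact absurd hle (not_le.2 hc0)

/-- **THE CLASSIFICATION STUB ON THE VOID CORNER, EVERY `ε₀`.** The implication of the registered stub
`stub_eternalIsDSS` of K2(1) — a forward-(S₁)-surviving admissible eternal solution ⇒ a non-trivial (S₁)-surviving
admissible DSS wave — holds for every cancelling outflow-free table and EVERY `ε₀`, because its hypothesis is void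
there (`not_eternalSurvivingFwd_of_outflow_zero`). Vacuous calibration: nothing is classified.
[cite: Tao2016AveragedNS, §4 (4.3), (4.8), §6.4; cell vocabulary (`stub_eternalIsDSS` of skeleton 9d85f4d387c689cd)] -/
theorem stubEternalIsDSS_on_outflow_zero (hc : IsCancellingCoeff α)
    (hA : ∀ i₁ i₂ i, α i₁ i₂ i ((0 : ℤ), (0 : ℤ), (1 : ℤ)) = 0) (ε₀ : ℝ)
    (hex : ∃ W : ℤ → ℝ → Em m, IsEternal ε₀ α W ∧ EternalSurvivingFwd 1 ε₀ W) :
    ∃ (q : ℕ) (π : Equiv.Perm (Fin q)) (T : ℝ) (Φ : Fin q → ℝ → Em m),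
      IsDSSWave ε₀ α π T Φ ∧ Surviving 1 ε₀ T ∧ ∃ r x, Φ r x ≠ 0 := by
  obtain ⟨W, hW, hS⟩ := hex
  exact absurd hS (not_eternalSurvivingFwd_of_outflow_zero hc hA hW 1)

/-! ## Numbers: a surviving eternal solution forces a live outflow constant `≥ 1/R` -/

/-- Each outflow constant is bounded by the flux constant: `|α_{i₁i₂i,(0,0,1)}| ≤ C_A(α)`.
[cite: Tao2016AveragedNS, §4 (4.1); cell vocabulary (`fluxConst`)] -/
theorem abs_outflow_le_fluxConst (α : Fin m → Fin m → Fin m → ℤ × ℤ × ℤ → ℝ) (i₁ i₂ i : Fin m) :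
    |α i₁ i₂ i ((0 : ℤ), (0 : ℤ), (1 : ℤ))| ≤ fluxConst α := by
  unfold fluxConst
  refine le_trans ?_ (Finset.single_le_sum (f := fun i => ∑ i₁, ∑ i₂, |α i₁ i₂ i (0, 0, 1)|)
    (fun j _ => Finset.sum_nonneg fun _ _ => Finset.sum_nonneg fun _ _ => abs_nonneg _)
    (Finset.mem_univ i))
  refine le_trans ?_ (Finset.single_le_sum (f := fun i₁ => ∑ i₂, |α i₁ i₂ i (0, 0, 1)|)
    (fun j _ => Finset.sum_nonneg fun _ _ => abs_nonneg _) (Finset.mem_univ i₁))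
  exact Finset.single_le_sum (f := fun i₂ => |α i₁ i₂ i (0, 0, 1)|) (fun j _ => abs_nonneg _)
    (Finset.mem_univ i₂)

/-- **A surviving admissible eternal solution forces a live outflow constant.** If `α ∈ E₂(R)` carries an
admissible eternal solution (`IsEternal ε₀ α W`, ANY `ε₀`) that is (S_a)-surviving forward for some `a`, then some
structure constant at the outflow shift has `R⁻¹ ≤ |α_{i₁i₂i,(0,0,1)}|` (contrapositive of
`not_eternalSurvivingFwd_of_outflow_zero` with the comparability dichotomy of `E₂(R)`).
[cite: Tao2016AveragedNS, §4 (4.3), (4.8), §6.1 (comparable tables); cell vocabulary (`InTableClass`, `IsEternal`, `EternalSurvivingFwd`)] -/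
theorem exists_outflow_ge_of_eternalSurviving (hα : InTableClass R α) {W : ℤ → ℝ → Em m} {a : ℝ}
    (hW : IsEternal ε₀ α W) (hS : EternalSurvivingFwd a ε₀ W) :
    ∃ i₁ i₂ i, R⁻¹ ≤ |α i₁ i₂ i ((0 : ℤ), (0 : ℤ), (1 : ℤ))| := by
  by_contra h
  push Not at h
  have hA : ∀ i₁ i₂ i, α i₁ i₂ i ((0 : ℤ), (0 : ℤ), (1 : ℤ)) = 0 := by
    intro i₁ i₂ i
    have h001 : ((0 : ℤ), (0 : ℤ), (1 : ℤ)) ∈ shiftSet := by simp [shiftSet]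
    rcases (hα.2.2 i₁ i₂ i _ h001).2 with hz | hge
    · exact hz
    · exact absurd hge (not_le.2 (h i₁ i₂ i))
  exact not_eternalSurvivingFwd_of_outflow_zero hα.2.1 hA hW a hS

/-- Hence **a surviving admissible eternal solution on `E₂(R)` forces `fluxConst α ≥ R⁻¹`** — the eternal
analogue of `fluxConst_ge_of_noGlobalCascade` and `fluxConst_ge_of_dssWave_nontrivial`: hypothesis AND conclusion
of BOTH registered stubs of K2(1) live on tables with a forward coupling of size `≥ 1/R`.
[cite: Tao2016AveragedNS, §4 (4.1), (4.3), §6.1; cell vocabulary (`fluxConst`, `IsEternal`)] -/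
theorem fluxConst_ge_of_eternalSurviving (hα : InTableClass R α) {W : ℤ → ℝ → Em m} {a : ℝ}
    (hW : IsEternal ε₀ α W) (hS : EternalSurvivingFwd a ε₀ W) : R⁻¹ ≤ fluxConst α := by
  obtain ⟨i₁, i₂, i, h⟩ := exists_outflow_ge_of_eternalSurviving hα hW hS
  exact h.trans (abs_outflow_le_fluxConst α i₁ i₂ i)

/-! ## Below the dyadic spread the live outflow is a cross coefficient -/

/-- Below the dyadic spread a live outflow constant is a CROSS coefficient: if `α ∈ E₂(R)`, `0 < R < 2`, and
`R⁻¹ ≤ |α_{i₁i₂i,(0,0,1)}|`, then `i₁ ≠ i₂` (square outflow coefficients vanish, `isSquareFreeCoeff_of_lt_two`).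
[cite: Tao2016AveragedNS, §4 (4.2)–(4.3), §6.1; cell vocabulary (`InTableClass`)] -/
theorem ne_of_outflow_ge_of_lt_two (hα : InTableClass R α) (hR0 : 0 < R) (hR : R < 2) {i₁ i₂ i : Fin m}
    (h : R⁻¹ ≤ |α i₁ i₂ i ((0 : ℤ), (0 : ℤ), (1 : ℤ))|) : i₁ ≠ i₂ := by
  intro h12
  subst h12
  have h0 : α i₁ i₁ i ((0 : ℤ), (0 : ℤ), (1 : ℤ)) = 0 :=
    isSquareFreeCoeff_of_lt_two hα hR0 hR i₁ i _ (by simp [shiftSet]) rfl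
  rw [h0, abs_zero] at h
  exact absurd h (not_le.2 (inv_pos.2 hR0))

/-- **Below the dyadic spread a robust blow-up forces a live CROSS outflow.** If `α ∈ E₂(R)`, `0 < R < 2`, and
`NoGlobalCascade ε₀ α X₀` (`ε₀ > 0`), then some `α_{jk i,(0,0,1)}` with `j ≠ k` has modulus `≥ R⁻¹`.
[cite: Tao2016AveragedNS, §4 (4.1)–(4.3), Thm. 4.2 (statement shape), §6.1; cell vocabulary (`InTableClass`, `NoGlobalCascade`)] -/
theorem exists_crossOutflow_ge_of_noGlobalCascade_of_lt_two (hε : 0 < ε₀) (hα : InTableClass R α)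
    (hR0 : 0 < R) (hR : R < 2) {X₀ : Fin m → ℝ} (hNG : NoGlobalCascade ε₀ α X₀) :
    ∃ j k i, j ≠ k ∧ R⁻¹ ≤ |α j k i ((0 : ℤ), (0 : ℤ), (1 : ℤ))| := by
  obtain ⟨i₁, i₂, i, h⟩ := exists_outflow_ge_of_noGlobalCascade hε hα hNG
  exact ⟨i₁, i₂, i, ne_of_outflow_ge_of_lt_two hα hR0 hR h, h⟩

/-- **Below the dyadic spread a non-trivial admissible DSS wave forces a live CROSS outflow.** If `α ∈ E₂(R)`,
`0 < R < 2`, carries an admissible DSS wave with `Φ r x ≠ 0` for some `r, x` (any `ε₀`), then some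
`α_{jk i,(0,0,1)}` with `j ≠ k` has modulus `≥ R⁻¹`.
[cite: Tao2016AveragedNS, §4 (4.1)–(4.3), Lemma 4.1 (iii) (4.8), §6.1; cell vocabulary (`IsDSSWave`, `InTableClass`)] -/
theorem exists_crossOutflow_ge_of_dssWave_nontrivial_of_lt_two (hα : InTableClass R α) (hR0 : 0 < R)
    (hR : R < 2) {ρ : Type*} [Fintype ρ] {π : Equiv.Perm ρ} {T : ℝ} {Φ : ρ → ℝ → Em m}
    (hW : IsDSSWave ε₀ α π T Φ) (hne : ∃ r x, Φ r x ≠ 0) :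
    ∃ j k i, j ≠ k ∧ R⁻¹ ≤ |α j k i ((0 : ℤ), (0 : ℤ), (1 : ℤ))| := by
  obtain ⟨i₁, i₂, i, h⟩ := exists_outflow_ge_of_dssWave_nontrivial hα hW hne
  exact ⟨i₁, i₂, i, ne_of_outflow_ge_of_lt_two hα hR0 hR h, h⟩

/-- **Below the dyadic spread a surviving admissible eternal solution forces a live CROSS outflow.** If
`α ∈ E₂(R)`, `0 < R < 2`, carries an admissible eternal solution that is (S_a)-surviving forward (any `a`, any `ε₀`),
then some `α_{jk i,(0,0,1)}` with `j ≠ k` has modulus `≥ R⁻¹`.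
[cite: Tao2016AveragedNS, §4 (4.1)–(4.3), (4.8), §6.1; cell vocabulary (`IsEternal`, `EternalSurvivingFwd`, `InTableClass`)] -/
theorem exists_crossOutflow_ge_of_eternalSurviving_of_lt_two (hα : InTableClass R α) (hR0 : 0 < R)
    (hR : R < 2) {W : ℤ → ℝ → Em m} {a : ℝ} (hW : IsEternal ε₀ α W) (hS : EternalSurvivingFwd a ε₀ W) :
    ∃ j k i, j ≠ k ∧ R⁻¹ ≤ |α j k i ((0 : ℤ), (0 : ℤ), (1 : ℤ))| := by
  obtain ⟨i₁, i₂, i, h⟩ := exists_outflow_ge_of_eternalSurviving hα hW hS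
  exact ⟨i₁, i₂, i, ne_of_outflow_ge_of_lt_two hα hR0 hR h, h⟩

/-! ## By-name normal forms: two charged modes below the dyadic spread -/

/-- **K2(1) ⟺ K2(1) ON TWO-MODE DATA BELOW THE DYADIC SPREAD.** `BlowupRigidityOne` is equivalent to the same
implication demanded only of data `X₀` charging two distinct modes whenever `R < 2` — one-mode data of sub-dyadic
tables carry no robust blow-up (`two_modes_of_noGlobalCascade_of_lt_two`).
[cite: Tao2016AveragedNS, §4 Thm. 4.2 (statement shape), (4.2)–(4.3); cell vocabulary (K2(1))] -/
theorem blowupRigidityOne_iff_twoModes_below_two :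
    BlowupRigidityOne ↔
      ∀ R : ℝ, 1 ≤ R → ∃ εs : ℝ, 0 < εs ∧ ∀ ε₀ : ℝ, 0 < ε₀ → ε₀ ≤ εs →
        ∀ (α : Fin 4 → Fin 4 → Fin 4 → ℤ × ℤ × ℤ → ℝ) (X₀ : Fin 4 → ℝ),
          InTableClass R α → (R < 2 → ∃ j k : Fin 4, j ≠ k ∧ X₀ j ≠ 0 ∧ X₀ k ≠ 0) →
            NoGlobalCascade ε₀ α X₀ →
              ∃ (q : ℕ) (π : Equiv.Perm (Fin q)) (T : ℝ) (Φ : Fin q → ℝ → Em 4),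
                IsDSSWave ε₀ α π T Φ ∧ Surviving 1 ε₀ T ∧ ∃ r x, Φ r x ≠ 0 := by
  constructor
  · intro h R hR
    obtain ⟨εs, hεs, H⟩ := h R hR
    exact ⟨εs, hεs, fun ε₀ hε hle α X₀ hα _ hNG => H ε₀ hε hle α X₀ hα hNG⟩
  · intro h R hR
    obtain ⟨εs, hεs, H⟩ := h R hR
    refine ⟨εs, hεs, fun ε₀ hε hle α X₀ hα hNG => H ε₀ hε hle α X₀ hα (fun hR2 => ?_) hNG⟩
    exact two_modes_of_noGlobalCascade_of_lt_two hα (by linarith) hR2 hNG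

/-- **The rung leaf ⟺ the rung leaf ON TWO-MODE DATA BELOW THE DYADIC SPREAD.** `Target` (BP-D-latt) is
equivalent to the same statement demanded only of data charging two distinct modes whenever `R < 2`.
[cite: Tao2016AveragedNS, §4 Thm. 4.2 (statement shape), (4.2)–(4.3); cell vocabulary (`Target` = `RungTwoBreakLatt`)] -/
theorem target_iff_twoModes_below_two :
    Target ↔
      ∀ R : ℝ, 1 ≤ R → ∃ εR : ℝ, 0 < εR ∧ ∀ ε₀ : ℝ, 0 < ε₀ → ε₀ ≤ εR →
        ∀ (α : Fin 4 → Fin 4 → Fin 4 → ℤ × ℤ × ℤ → ℝ) (X₀ : Fin 4 → ℝ),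
          InTableClass R α → (R < 2 → ∃ j k : Fin 4, j ≠ k ∧ X₀ j ≠ 0 ∧ X₀ k ≠ 0) →
            ¬ NoGlobalCascade ε₀ α X₀ := by
  constructor
  · intro h R hR
    obtain ⟨εR, hεR, H⟩ := h R hR
    exact ⟨εR, hεR, fun ε₀ hε hle α X₀ hα _ => H ε₀ hε hle α X₀ hα⟩
  · intro h R hR
    obtain ⟨εR, hεR, H⟩ := h R hR
    refine ⟨εR, hεR, fun ε₀ hε hle α X₀ hα hNG => ?_⟩
    exact H ε₀ hε hle α X₀ hα (fun hR2 => two_modes_of_noGlobalCascade_of_lt_two hα (by linarith) hR2 hNG)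
      hNG

end BlowupRigidityOne

end Summit.NavierStokesRegularity.NavierStokesRegularity.Theorems

end
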